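import Mathlib
import Literature.Analysis.FluidPDE.TypeIICoreWitness
import Literature.Analysis.FluidPDE.AxisymHouLiVariables
import Summits.NavierStokesRegularity.NavierStokesRegularity.Theorems.TypeIIInviscidRelaxationAxisymSwirlRegularRadialMomentumCalculus
import HarnessLib

/-!
# Cruxes `ColumnarCoreExclusion` (stmt-1966) / `MonopoleCoreExclusion` (stmt-1965): the INTERSECTION of the two
# comparison classes — a divergence-free `C¹` field that is both columnar and axisymmetric has no radial component

`--supports stmt-NavierStokesRegularity-1966` (helper file; theorems only, no definitions, no `sorry`).

The two comparison-flow lines of the route `TypeIIInviscidRelaxation` shadow the blow-up solution by an exactly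
COLUMNAR flow (`IsColumnar`, line `columnar_comparison_flow`, 1966) resp. an exactly AXISYMMETRIC flow
(`IsAxisymmetric`, line `axisymmetric_comparison_flow`, 1965), and their [XL] shadowing stubs coincide on comparison
flows lying in both classes.  This file identifies that common class kinematically: if `W : ℝ³ → ℝ³` is `C¹`,
divergence free, columnar (`W (y + τ e_z) = W y`) and axisymmetric (`W (R_θ y) = R_θ W y`), then its RADIAL MOMENTUM
`Φ = x₀W₀ + x₁W₁ = r·W_r` — the very quantity whose sign the two stubs of crux `AxisymSwirlRegular` (stmt-1964)
control — vanishes identically (`radialMomentum_eq_zero_of_isColumnar_of_isAxisymmetric`), i.e. `W` has no radial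
component (`radialVelocity_eq_zero_of_isColumnar_of_isAxisymmetric`): the common comparison flows are the swirling
jets / vortex columns `W = W_θ(r) e_θ + W_z(r) e_z` (Lamb–Oseen / Burgers-type columns with axial flow, the
filament-core class).

Proof.  Columnar ⇒ `DW(y)[e_z] = 0` (`fderiv_apply_eZ_eq_zero_of_isColumnar`), so `div W = 0` reads
`∂₀W₀ + ∂₁W₁ = 0` (`divH_eq_zero_of_isColumnar_of_isDivFree`); the infinitesimal axisymmetry identity of the tree
`DΦ(y)[y_h] = r²(∂₀W₀ + ∂₁W₁)` (`fderiv_radialMomentum_horizontal_of_isAxisymmetric`) then kills the radial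
derivative of `Φ`, so `s ↦ Φ(s·y_h)` has zero derivative (at `s = 0` because the horizontal velocity of an
axisymmetric field vanishes on the axis) and is constant `= Φ(0) = 0`; finally `Φ(y) = Φ(y_h)` by columnarity.

Nothing about Navier–Stokes regularity is claimed; no stub is closed by name.
-/

noncomputable section

open Set Function WithLp
open Literature.Analysis Literature.Analysis.FluidPDE

namespace Summit.NavierStokesRegularity.NavierStokesRegularity.Theorems

-- the problem directory repeats the summit name (`NavierStokesRegularity/NavierStokesRegularity`)
set_option linter.dupNamespace false

namespace CoreExclusionComparisonClass

/-- **A columnar field has no axial derivative**: `IsColumnar W`, `W` differentiable at `x` ⟹ `DW(x)[e_z] = 0`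
(differentiate `τ ↦ W (x + τ e_z) = W x` at `τ = 0`). [folklore] -/
theorem fderiv_apply_eZ_eq_zero_of_isColumnar {W : EuclideanSpace ℝ (Fin 3) → EuclideanSpace ℝ (Fin 3)}
    (hcol : IsColumnar W) {x : EuclideanSpace ℝ (Fin 3)} (hd : DifferentiableAt ℝ W x) :
    fderiv ℝ W x eZ = 0 := by
  have h1 : HasDerivAt (fun τ : ℝ => W (x + τ • eZ)) (fderiv ℝ W x eZ) 0 := by
    have hW : HasFDerivAt W (fderiv ℝ W x) (x + (0 : ℝ) • eZ) := by
      rw [zero_smul, add_zero]; exact hd.hasFDerivAt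
    have hγ : HasDerivAt (fun τ : ℝ => x + τ • eZ) eZ 0 := by
      have h := ((hasDerivAt_id (0 : ℝ)).smul_const eZ).const_add x
      rwa [one_smul] at h
    exact hW.comp_hasDerivAt (0 : ℝ) hγ
  have h2 : HasDerivAt (fun τ : ℝ => W (x + τ • eZ)) 0 0 := by
    have : (fun τ : ℝ => W (x + τ • eZ)) = fun _ => W x := funext fun τ => hcol x τ
    rw [this]
    exact hasDerivAt_const _ _
  exact h1.unique h2

/-- **Horizontal divergence of a columnar divergence-free field**: `∂₀W₀ + ∂₁W₁ = 0` (the axial term `∂₂W₂` of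
`div W = 0` vanishes by `fderiv_apply_eZ_eq_zero_of_isColumnar`). [folklore] -/
theorem divH_eq_zero_of_isColumnar_of_isDivFree {W : EuclideanSpace ℝ (Fin 3) → EuclideanSpace ℝ (Fin 3)}
    (hcol : IsColumnar W) (hdiv : VectorCalculus.IsDivFree W) {x : EuclideanSpace ℝ (Fin 3)}
    (hd : DifferentiableAt ℝ W x) :
    fderiv ℝ W x (EuclideanSpace.single 0 1) 0 + fderiv ℝ W x (EuclideanSpace.single 1 1) 1 = 0 := by
  have h := hdiv x
  rw [divergence_eq_sum_three] at h
  have hz : fderiv ℝ W x (EuclideanSpace.single 2 1) = 0 := fderiv_apply_eZ_eq_zero_of_isColumnar hcol hd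
  rw [hz] at h
  simpa using h

/-- **The radial derivative of the radial momentum vanishes** for a `C¹` divergence-free field that is columnar and
axisymmetric: `DΦ(y)[(y₀, y₁, 0)] = 0`, `Φ = x₀W₀ + x₁W₁` (the tree identity `DΦ(y)[y_h] = r²(∂₀W₀ + ∂₁W₁)` and
`divH_eq_zero_of_isColumnar_of_isDivFree`). [folklore] -/
theorem fderiv_radialMomentum_horizontal_eq_zero {W : EuclideanSpace ℝ (Fin 3) → EuclideanSpace ℝ (Fin 3)}
    (hcol : IsColumnar W) (hax : IsAxisymmetric W) (hdiv : VectorCalculus.IsDivFree W)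
    {y : EuclideanSpace ℝ (Fin 3)} (hd : DifferentiableAt ℝ W y) :
    fderiv ℝ (fun y : EuclideanSpace ℝ (Fin 3) => y 0 * W y 0 + y 1 * W y 1) y (toLp 2 ![y 0, y 1, 0]) = 0 := by
  rw [fderiv_radialMomentum_horizontal_of_isAxisymmetric hax hd,
    divH_eq_zero_of_isColumnar_of_isDivFree hcol hdiv hd, mul_zero]

/-- **A divergence-free `C¹` field that is both columnar and axisymmetric has vanishing radial momentum**:
`x₀W₀(x) + x₁W₁(x) = 0` for all `x` — i.e. `r·W_r ≡ 0`, `W = W_θ(r) e_θ + W_z(r) e_z` is a vortex column with axial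
flow.  (The quantity `x₀u₀ + x₁u₁` is the one-sided radial inflow of the stubs of crux `AxisymSwirlRegular`; for the
comparison flows common to the columnar and the axisymmetric line it is identically zero.) [folklore] -/
theorem radialMomentum_eq_zero_of_isColumnar_of_isAxisymmetric
    {W : EuclideanSpace ℝ (Fin 3) → EuclideanSpace ℝ (Fin 3)} (hW : ContDiff ℝ 1 W)
    (hcol : IsColumnar W) (hax : IsAxisymmetric W) (hdiv : VectorCalculus.IsDivFree W)
    (x : EuclideanSpace ℝ (Fin 3)) : x 0 * W x 0 + x 1 * W x 1 = 0 := by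
  set Φ : EuclideanSpace ℝ (Fin 3) → ℝ := fun y => y 0 * W y 0 + y 1 * W y 1 with hΦ
  have hWd : Differentiable ℝ W := hW.differentiable one_ne_zero
  have hΦd : Differentiable ℝ Φ := (contDiff_radialMomentum hW).differentiable one_ne_zero
  -- the horizontal point `xh = (x₀, x₁, 0)`; `Φ x = Φ xh` by columnarity
  set xh : EuclideanSpace ℝ (Fin 3) := toLp 2 ![x 0, x 1, 0] with hxh
  have hxh0 : xh 0 = x 0 := by simp [hxh]
  have hxh1 : xh 1 = x 1 := by simp [hxh]
  have hx : x = xh + (x 2 - xh 2) • eZ := eq_add_smul_eZ_of_apply_eq hxh0.symm hxh1.symm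
  have hΦcol : Φ x = Φ xh := by
    have h1 : W x = W xh := by rw [hx]; exact hcol xh _
    show x 0 * W x 0 + x 1 * W x 1 = xh 0 * W xh 0 + xh 1 * W xh 1
    rw [h1, hxh0, hxh1]
  -- `g(s) = Φ (s • xh)` has zero derivative everywhere
  have hg : ∀ s : ℝ, HasDerivAt (fun s : ℝ => Φ (s • xh)) 0 s := by
    intro s
    have hc : HasDerivAt (fun s : ℝ => Φ (s • xh)) (fderiv ℝ Φ (s • xh) xh) s := by
      have h1 : HasDerivAt (fun s : ℝ => s • xh) xh s := by
        have h := (hasDerivAt_id s).smul_const xh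
        rwa [one_smul] at h
      exact ((hΦd (s • xh)).hasFDerivAt).comp_hasDerivAt s h1
    have hzero : fderiv ℝ Φ (s • xh) xh = 0 := by
      rcases eq_or_ne s 0 with rfl | hs
      · -- at the origin: `DΦ(0)[h] = h₀W₀(0) + h₁W₁(0)` and the horizontal velocity vanishes on the axis
        have h00 : W 0 0 = 0 := hax.apply_zero_eq_zero_of_axis hWd (x := 0) rfl rfl
        have h01 : W 0 1 = 0 := hax.apply_one_eq_zero_of_axis hWd (x := 0) rfl rfl
        rw [zero_smul, hΦ, fderiv_radialMomentum_apply (hWd 0)]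
        simp [h00, h01]
      · -- off the origin: `(s • xh)_h = s • xh`, and the radial derivative vanishes
        have hh : (toLp 2 ![(s • xh) 0, (s • xh) 1, 0] : EuclideanSpace ℝ (Fin 3)) = s • xh := by
          ext i
          fin_cases i <;> simp [hxh]
        have h := fderiv_radialMomentum_horizontal_eq_zero hcol hax hdiv (hWd (s • xh))
        rw [hh, map_smul, smul_eq_mul] at h
        exact (mul_eq_zero.1 h).resolve_left hs
    rw [hzero] at hc
    exact hc
  have hconst := is_const_of_deriv_eq_zero (f := fun s : ℝ => Φ (s • xh))
    (fun s => (hg s).differentiableAt) (fun s => (hg s).deriv)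
  have h10 : Φ ((1 : ℝ) • xh) = Φ ((0 : ℝ) • xh) := hconst 1 0
  rw [one_smul, zero_smul] at h10
  have hΦ0 : Φ 0 = 0 := by simp [hΦ]
  show Φ x = 0
  rw [hΦcol, h10, hΦ0]

/-- **No radial component**: for a `C¹` divergence-free field that is columnar and axisymmetric, the radial velocity
`W_r = ⟪W x, e_r x⟫` vanishes everywhere (off the axis from `r·W_r = x₀W₀ + x₁W₁ = 0`; on the axis `e_r = 0`).
[folklore] -/
theorem radialVelocity_eq_zero_of_isColumnar_of_isAxisymmetric
    {W : EuclideanSpace ℝ (Fin 3) → EuclideanSpace ℝ (Fin 3)} (hW : ContDiff ℝ 1 W)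
    (hcol : IsColumnar W) (hax : IsAxisymmetric W) (hdiv : VectorCalculus.IsDivFree W)
    (x : EuclideanSpace ℝ (Fin 3)) : radialVelocity W x = 0 := by
  have h := radialMomentum_eq_zero_of_isColumnar_of_isAxisymmetric hW hcol hax hdiv x
  unfold radialVelocity eR
  rw [inner_smul_right]
  have hinner : @inner ℝ _ _ (W x) (toLp 2 ![x 0, x 1, 0] : EuclideanSpace ℝ (Fin 3)) =
      x 0 * W x 0 + x 1 * W x 1 := by
    simp [EuclideanSpace.inner_eq_star_dotProduct, Fin.sum_univ_three, dotProduct]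
  rw [hinner, h, mul_zero]

end CoreExclusionComparisonClass

end Summit.NavierStokesRegularity.NavierStokesRegularity.Theorems

end
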